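import Summits.AtomisticToContinuum.FouriersLaw.Theses.JunctionLocality
import Summits.AtomisticToContinuum.FouriersLaw.Theses.ParityLiouvilleSeed

/-!
# `SuperadditiveResistance` / Negative (1/2): read-back, load-bearing shell, kill criteria, slab dichotomy

Support file (`--supports stmt-AtomisticToContinuum-11748`) of the standing disprover seat for the crux
`JunctionLocality.SuperadditiveResistance` (twin `ParityLiouvilleSeed.SuperadditiveResistance`): bounded
reservoir-insertion cost `R_{N+M} ≥ R_N + R_M - C`, `R_N := (N-1)/D_N`, for `pinnedChain ω₂ lam β γ`
(all `> 0`).  The crux is NOT refuted; this file lands what is certain around it: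

* read-back (`superadditiveResistance_iff`, `Iff.rfl`; `twin_eq`, `rfl`);
* LOAD-BEARING: the arithmetic shell with every dynamical hypothesis dropped is false
  (`superadditiveResistance_false_without_dynamics`) — any proof must use the dynamics;
* KILL CRITERIA (pure real analysis): bounded insertion cost ⇒ bounded doubling defect
  (`insertionBounded_doubling`); an affine resistance law plus a correction with unbounded doubling excess
  (`not_insertionBounded_of_doubling_excess`), in particular `+ b·N^s` (`b > 0`, `0 < s < 1`) or
  `+ b·log N` (`b > 0`), violates it; a SUBADDITIVE DIP `- e_N` does not (one-sidedness);
* SLAB CARICATURE DICHOTOMY (pure algebra): for parallel ballistic-then-diffusive channels `(w_m, ℓ_m)` the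
  doubling defect dominates `Σ_{ℓ_m ≤ N} w_m ℓ_m²/(3κ²)` (`slab_doubling_defect_ge`) and conversely the
  insertion defect is at most `4M₂/κ²` beyond length `2M₂/κ` (`slab_insertion_defect_le`): bounded insertion
  cost ⟺ bounded `w`-second moment of the mean free path — the statistic any junction-repair lemma controls.

Companion file (2/2): `HarmonicCornerTightness.lean`.  No new definitions.
cdisprove seat refuter-cdisprove-stmt-AtomisticToContinuum-11748-0, 2026-08-16.
-/

noncomputable section

namespace Summit.AtomisticToContinuum.FouriersLaw.Theorems.SuperadditiveResistance.Negative

open MeasureTheory Filter Topology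
open Literature.MathematicalPhysics.KineticTheory.HeatConduction
open Summit.AtomisticToContinuum.FouriersLaw.Theses

/-! ## Read-back -/

/-- Read-back (definitional): the crux restated verbatim over the Literature vocabulary. [folklore] -/
theorem superadditiveResistance_iff :
    JunctionLocality.SuperadditiveResistance ↔
      ∀ ω₂ lam β γ : ℝ, 0 < ω₂ → 0 < lam → 0 < β → 0 < γ →
        (∀ (N : ℕ) (T_L T_R : ℝ), 0 < T_L → 0 < T_R → ∀ μ ν : Measure (PhaseSpace N),
          (pinnedChain ω₂ lam β γ).IsSteadyState N T_L T_R μ →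
          (pinnedChain ω₂ lam β γ).IsSteadyState N T_L T_R ν → μ = ν) →
        ∀ μ : (N : ℕ) → ℝ → ℝ → Measure (PhaseSpace N),
          (∀ (N : ℕ) (T_L T_R : ℝ), 0 < T_L → 0 < T_R →
            (pinnedChain ω₂ lam β γ).IsSteadyState N T_L T_R (μ N T_L T_R)) →
          ∀ T : ℝ, 0 < T → ∀ D : ℕ → ℝ,
            (∀ N : ℕ, Tendsto (fun δ : ℝ =>
                (pinnedChain ω₂ lam β γ).totalCurrent (μ N (T + δ / 2) (T - δ / 2)) / δ)
              (𝓝[≠] 0) (𝓝 (D N))) →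
            (∀ N : ℕ, 2 ≤ N → 0 < D N) →
              (∃ C : ℝ, ∀ N M : ℕ, 2 ≤ N → 2 ≤ M →
                ((N : ℝ) - 1) / D N + ((M : ℝ) - 1) / D M - C ≤ ((N : ℝ) + (M : ℝ) - 1) / D (N + M)) :=
  Iff.rfl

/-- The two route copies of the crux are the same proposition. [folklore] -/
theorem twin_eq :
    ParityLiouvilleSeed.SuperadditiveResistance = JunctionLocality.SuperadditiveResistance :=
  rfl

/-! ## Kill criteria (pure real analysis) -/

/-- (A) ⇒ the doubling defect is bounded: `2 R_N - C ≤ R_{2N}` for all `N ≥ 2`. [folklore] -/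
theorem insertionBounded_doubling {D : ℕ → ℝ}
    (h : (∃ C : ℝ, ∀ N M : ℕ, 2 ≤ N → 2 ≤ M →
      ((N : ℝ) - 1) / D N + ((M : ℝ) - 1) / D M - C ≤ ((N : ℝ) + (M : ℝ) - 1) / D (N + M))) :
    ∃ C : ℝ, ∀ N : ℕ, 2 ≤ N →
      2 * (((N : ℝ) - 1) / D N) - C ≤ ((N : ℝ) + (N : ℝ) - 1) / D (N + N) := by
  obtain ⟨C, hC⟩ := h
  refine ⟨C, fun N hN => ?_⟩
  have := hC N N hN hN
  linarith

/-- Kill criterion (abstract): if `R_N = ℓ·N + a + e_N` for `N ≥ 2` and the doubling excess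
`2 e_N - e_{2N}` is unbounded above (tends to `+∞`), then (A) fails. [folklore] -/
theorem not_insertionBounded_of_doubling_excess {D : ℕ → ℝ} (ℓ a : ℝ) (e : ℕ → ℝ)
    (hR : ∀ N : ℕ, 2 ≤ N → ((N : ℝ) - 1) / D N = ℓ * N + a + e N)
    (he : Tendsto (fun N : ℕ => 2 * e N - e (2 * N)) atTop atTop) :
    ¬ (∃ C : ℝ, ∀ N M : ℕ, 2 ≤ N → 2 ≤ M →
      ((N : ℝ) - 1) / D N + ((M : ℝ) - 1) / D M - C ≤ ((N : ℝ) + (M : ℝ) - 1) / D (N + M)) := by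
  intro h
  obtain ⟨C, hC⟩ := insertionBounded_doubling h
  obtain ⟨N₀, hN₀⟩ := (tendsto_atTop_atTop.mp he) (C - a + 1)
  set N := max N₀ 2 with hNdef
  have hN2 : 2 ≤ N := le_max_right _ _
  have hNN : 2 ≤ N + N := by omega
  have h1 := hC N hN2
  have h2 := hN₀ N (le_max_left _ _)
  rw [hR N hN2] at h1
  have h3 : ((N : ℝ) + (N : ℝ) - 1) / D (N + N) = ℓ * ((N + N : ℕ) : ℝ) + a + e (N + N) := by
    rw [← hR (N + N) hNN]; push_cast; ring
  rw [h3] at h1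
  have h4 : e (2 * N) = e (N + N) := by rw [two_mul]
  rw [h4] at h2
  push_cast at h1
  linarith

/-- Kill criterion (power law): `R_N = ℓ·N + a + b·N^s` with `b > 0`, `0 < s < 1` violates (A)
(`2bN^s - b(2N)^s = b(2 - 2^s)N^s → ∞`).  This is the "finite-size corrections slower than `1/N`"
kill of the card: `κ_N = (N-1)/R_N` approaches `κ = 1/ℓ` from BELOW like `N^{s-1} ≫ 1/N`. [folklore] -/
theorem not_insertionBounded_of_rpow_correction {D : ℕ → ℝ} (ℓ a b s : ℝ) (hb : 0 < b)
    (hs0 : 0 < s) (hs1 : s < 1)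
    (hR : ∀ N : ℕ, 2 ≤ N → ((N : ℝ) - 1) / D N = ℓ * N + a + b * (N : ℝ) ^ s) :
    ¬ (∃ C : ℝ, ∀ N M : ℕ, 2 ≤ N → 2 ≤ M →
      ((N : ℝ) - 1) / D N + ((M : ℝ) - 1) / D M - C ≤ ((N : ℝ) + (M : ℝ) - 1) / D (N + M)) := by
  refine not_insertionBounded_of_doubling_excess ℓ a (fun N => b * (N : ℝ) ^ s) hR ?_
  have h2s : (2 : ℝ) ^ s < 2 := by
    have := Real.rpow_lt_self_of_one_lt (by norm_num : (1 : ℝ) < 2) hs1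
    simpa using this
  have hcoef : 0 < b * (2 - (2 : ℝ) ^ s) := mul_pos hb (by linarith)
  have hlim : Tendsto (fun N : ℕ => b * (2 - (2 : ℝ) ^ s) * (N : ℝ) ^ s) atTop atTop :=
    Tendsto.const_mul_atTop hcoef
      ((tendsto_rpow_atTop hs0).comp tendsto_natCast_atTop_atTop)
  refine hlim.congr fun N => ?_
  have hN : (0 : ℝ) ≤ N := Nat.cast_nonneg N
  push_cast
  rw [Real.mul_rpow (by norm_num : (0 : ℝ) ≤ 2) hN]
  ring

/-- Kill criterion (logarithm, the marginal case): `R_N = ℓ·N + a + b·log N` with `b > 0` violates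
(A) (`2b log N - b log(2N) = b log(N/2) → ∞`), i.e. already `κ - κ_N ≍ (log N)/N` from below kills
the crux (a kinetic Peierls–Boltzmann slab caricature produces exactly this at the `lam = 0` edge of
the family, FPU-β interaction + harmonic pinning; see the seat's `Disproof.lean` §4 (iii)). [folklore] -/
theorem not_insertionBounded_of_log_correction {D : ℕ → ℝ} (ℓ a b : ℝ) (hb : 0 < b)
    (hR : ∀ N : ℕ, 2 ≤ N → ((N : ℝ) - 1) / D N = ℓ * N + a + b * Real.log N) :
    ¬ (∃ C : ℝ, ∀ N M : ℕ, 2 ≤ N → 2 ≤ M →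
      ((N : ℝ) - 1) / D N + ((M : ℝ) - 1) / D M - C ≤ ((N : ℝ) + (M : ℝ) - 1) / D (N + M)) := by
  refine not_insertionBounded_of_doubling_excess ℓ a (fun N => b * Real.log N) hR ?_
  have hlog : Tendsto (fun N : ℕ => Real.log (N : ℝ)) atTop atTop :=
    Real.tendsto_log_atTop.comp tendsto_natCast_atTop_atTop
  have hlim : Tendsto (fun N : ℕ => b * (Real.log (N : ℝ) - Real.log 2)) atTop atTop :=
    Tendsto.const_mul_atTop hb (tendsto_atTop_add_const_right _ _ hlog)
  refine hlim.congr' ?_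
  filter_upwards [eventually_ge_atTop 1] with N hN
  have hN : (N : ℝ) ≠ 0 := by exact_mod_cast (show N ≠ 0 by omega)
  push_cast
  rw [Real.log_mul (by norm_num) hN]
  ring

/-- One-sidedness: `R_N = ℓ·N + a - e_N` with a SUBADDITIVE dip `e` (`e_{N+M} ≤ e_N + e_M`)
satisfies (A) with `C = a`.  So (A) alone tolerates arbitrarily slow approach of `κ_N` to `κ` from
ABOVE; the `1/N` rate is pinned only by two-sided locality (`JunctionDichotomy`). [folklore] -/
theorem insertionBounded_of_subadditive_dip {D : ℕ → ℝ} (ℓ a : ℝ) (e : ℕ → ℝ)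
    (hR : ∀ N : ℕ, 2 ≤ N → ((N : ℝ) - 1) / D N = ℓ * N + a - e N)
    (he : ∀ N M : ℕ, 2 ≤ N → 2 ≤ M → e (N + M) ≤ e N + e M) :
    (∃ C : ℝ, ∀ N M : ℕ, 2 ≤ N → 2 ≤ M →
      ((N : ℝ) - 1) / D N + ((M : ℝ) - 1) / D M - C ≤ ((N : ℝ) + (M : ℝ) - 1) / D (N + M)) := by
  refine ⟨a, fun N M hN hM => ?_⟩
  have hNM : 2 ≤ N + M := by omega
  have h3 : ((N : ℝ) + (M : ℝ) - 1) / D (N + M) = ℓ * ((N + M : ℕ) : ℝ) + a - e (N + M) := by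
    rw [← hR (N + M) hNM]; push_cast; ring
  rw [hR N hN, hR M hM, h3]
  have := he N M hN hM
  push_cast
  linarith

/-- The power-law dip `e_N = b·N^s`, `b ≥ 0`, `0 ≤ s ≤ 1`, is subadditive, so
`R_N = ℓ·N + a - b·N^s` satisfies (A): `κ_N → κ` from above like `N^{s-1}` is invisible to (A). [folklore] -/
theorem insertionBounded_of_rpow_dip {D : ℕ → ℝ} (ℓ a b s : ℝ) (hb : 0 ≤ b) (hs0 : 0 ≤ s)
    (hs1 : s ≤ 1) (hR : ∀ N : ℕ, 2 ≤ N → ((N : ℝ) - 1) / D N = ℓ * N + a - b * (N : ℝ) ^ s) :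
    (∃ C : ℝ, ∀ N M : ℕ, 2 ≤ N → 2 ≤ M →
      ((N : ℝ) - 1) / D N + ((M : ℝ) - 1) / D M - C ≤ ((N : ℝ) + (M : ℝ) - 1) / D (N + M)) := by
  refine insertionBounded_of_subadditive_dip ℓ a (fun N => b * (N : ℝ) ^ s) hR ?_
  intro N M _ _
  have hN : (0 : ℝ) ≤ N := Nat.cast_nonneg N
  have hM : (0 : ℝ) ≤ M := Nat.cast_nonneg M
  have h := Real.rpow_add_le_add_rpow hN hM hs0 hs1
  push_cast
  nlinarith [h, hb]

/-! ## Spectral slab caricature: the insertion defect is the second moment of the mean free path -/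

/-- **Slab caricature of the junction-repair cost.**  Finitely many channels `m ∈ S` (phonon modes)
with weights `w_m ≥ 0` (velocity × contact transmission) and mean free paths `ℓ_m > 0` conduct in
parallel through a slab of length `x`, each as a ballistic-then-diffusive resistor:
`κ_x := Σ_m w_m ℓ_m · x/(x + ℓ_m)` (so `G_x = κ_x/x = Σ_m w_m/(1 + x/ℓ_m)`, `κ_x ↑ κ := Σ_m w_m ℓ_m`),
`R_x := x/κ_x`.  Then for every `N > 0` the DOUBLING DEFECT obeys
`2R_N - R_{2N} ≥ (Σ_{ℓ_m ≤ N} w_m ℓ_m²)/(3κ²)`: it dominates the `w`-second moment of the mean free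
paths below `N`.  Consequently, in this caricature, bounded insertion cost (the crux (A)) forces
`Σ_m w_m ℓ_m² = O(κ²·C)` uniformly — an UNBOUNDED second moment of the mean-free-path distribution
(long waves with `ℓ(k) ≍ 1/k`, `w ≍ k`: the `lam = 0` edge of the pinned family) kills (A) even when
`κ = Σ w ℓ < ∞` (normal conductivity).  This is the quantity a junction-repair lemma must control;
nothing here is specific to the chain (pure algebra of parallel affine resistors). [folklore] -/
theorem slab_doubling_defect_ge {ι : Type*} (S : Finset ι) (w ℓ : ι → ℝ)
    (hw : ∀ m ∈ S, 0 ≤ w m) (hℓ : ∀ m ∈ S, 0 < ℓ m) (hκ : 0 < ∑ m ∈ S, w m * ℓ m)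
    (κN : ℝ → ℝ) (hκN : ∀ x, κN x = ∑ m ∈ S, w m * ℓ m * (x / (x + ℓ m)))
    {N : ℝ} (hN : 0 < N) :
    (∑ m ∈ S.filter (fun m => ℓ m ≤ N), w m * ℓ m ^ 2) / (3 * (∑ m ∈ S, w m * ℓ m) ^ 2)
      ≤ 2 * (N / κN N) - 2 * N / κN (2 * N) := by
  set κ := ∑ m ∈ S, w m * ℓ m with hκdef
  -- basic bounds on κ_N
  have hterm_nonneg : ∀ x : ℝ, 0 < x → ∀ m ∈ S, 0 ≤ w m * ℓ m * (x / (x + ℓ m)) := by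
    intro x hx m hm
    have := hw m hm; have := hℓ m hm
    positivity
  have hle : ∀ x : ℝ, 0 < x → κN x ≤ κ := by
    intro x hx
    rw [hκN]
    refine Finset.sum_le_sum fun m hm => ?_
    have h1 : x / (x + ℓ m) ≤ 1 := by
      rw [div_le_one (by linarith [hℓ m hm])]; linarith [hℓ m hm]
    have h0 : 0 ≤ w m * ℓ m := mul_nonneg (hw m hm) (hℓ m hm).le
    calc w m * ℓ m * (x / (x + ℓ m)) ≤ w m * ℓ m * 1 :=
          mul_le_mul_of_nonneg_left h1 h0
      _ = w m * ℓ m := mul_one _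
  have hposN : ∀ x : ℝ, 0 < x → 0 < κN x := by
    intro x hx
    obtain ⟨m, hm, hmpos⟩ : ∃ m ∈ S, (0 : ℝ) < w m * ℓ m := by
      have : ∑ m ∈ S, (0 : ℝ) < ∑ m ∈ S, w m * ℓ m := by simpa using hκ
      exact Finset.exists_lt_of_sum_lt this
    rw [hκN]
    refine Finset.sum_pos' (hterm_nonneg x hx) ⟨m, hm, ?_⟩
    have := hℓ m hm
    exact mul_pos hmpos (div_pos hx (by linarith))
  set a := κN N with ha
  set b := κN (2 * N) with hb
  have ha0 : 0 < a := hposN N hN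
  have hb0 : 0 < b := hposN (2 * N) (by linarith)
  have haκ : a ≤ κ := hle N hN
  have hbκ : b ≤ κ := hle (2 * N) (by linarith)
  -- the increment κ_{2N} - κ_N, termwise
  have hdiff : b - a = ∑ m ∈ S, w m * ℓ m ^ 2 * (N / ((2 * N + ℓ m) * (N + ℓ m))) := by
    rw [hb, ha, hκN, hκN, ← Finset.sum_sub_distrib]
    refine Finset.sum_congr rfl fun m hm => ?_
    have h1 : N + ℓ m ≠ 0 := by linarith [hℓ m hm]
    have h2 : 2 * N + ℓ m ≠ 0 := by linarith [hℓ m hm]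
    field_simp
    ring
  -- lower bound of the increment by the second moment of the short mean free paths
  set F := ∑ m ∈ S.filter (fun m => ℓ m ≤ N), w m * ℓ m ^ 2 with hF
  have hF0 : 0 ≤ F := Finset.sum_nonneg fun m hm => by
    have := hw m (Finset.mem_filter.mp hm).1; positivity
  have hincr : F / (6 * N) ≤ b - a := by
    rw [hdiff]
    calc F / (6 * N) = ∑ m ∈ S.filter (fun m => ℓ m ≤ N), w m * ℓ m ^ 2 / (6 * N) := by
          rw [hF, Finset.sum_div]
      _ ≤ ∑ m ∈ S.filter (fun m => ℓ m ≤ N), w m * ℓ m ^ 2 * (N / ((2 * N + ℓ m) * (N + ℓ m))) := by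
          refine Finset.sum_le_sum fun m hm => ?_
          obtain ⟨hmS, hmN⟩ := Finset.mem_filter.mp hm
          have hl := hℓ m hmS
          have hw' := hw m hmS
          have hden : 0 < (2 * N + ℓ m) * (N + ℓ m) := by positivity
          have hfrac : 1 / (6 * N) ≤ N / ((2 * N + ℓ m) * (N + ℓ m)) := by
            rw [div_le_div_iff₀ (by positivity) hden]
            nlinarith
          have h0 : 0 ≤ w m * ℓ m ^ 2 := by positivity
          calc w m * ℓ m ^ 2 / (6 * N) = w m * ℓ m ^ 2 * (1 / (6 * N)) := by ring
            _ ≤ w m * ℓ m ^ 2 * (N / ((2 * N + ℓ m) * (N + ℓ m))) :=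
                mul_le_mul_of_nonneg_left hfrac h0
      _ ≤ ∑ m ∈ S, w m * ℓ m ^ 2 * (N / ((2 * N + ℓ m) * (N + ℓ m))) := by
          refine Finset.sum_le_sum_of_subset_of_nonneg (Finset.filter_subset _ _) ?_
          intro m hmS _
          have := hw m hmS; have := hℓ m hmS
          positivity
  -- assemble
  have hba : 0 ≤ b - a := le_trans (by positivity) hincr
  have h1 : 2 * (N / a) - 2 * N / b = 2 * N * (b - a) / (a * b) := by
    field_simp
  rw [h1]
  have hab : a * b ≤ κ ^ 2 := by
    rw [sq]; exact mul_le_mul haκ hbκ hb0.le (le_trans ha0.le haκ)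
  calc F / (3 * κ ^ 2) = 2 * N * (F / (6 * N)) / κ ^ 2 := by
        field_simp
        ring
    _ ≤ 2 * N * (b - a) / κ ^ 2 := by
        refine div_le_div_of_nonneg_right ?_ (by positivity)
        exact mul_le_mul_of_nonneg_left hincr (by positivity)
    _ ≤ 2 * N * (b - a) / (a * b) :=
        div_le_div_of_nonneg_left (by positivity) (by positivity) hab

/-- **Converse slab bound (the dichotomy is sharp).**  In the same caricature, once the lengths
exceed `2M₂/κ` (`M₂ := Σ_m w_m ℓ_m²` the `w`-second moment of the mean free paths), the insertion
defect is at most `4M₂/κ²`: `R_x + R_y - R_{x+y} ≤ 4M₂/κ²`.  Together with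
`slab_doubling_defect_ge`: in the slab caricature the optimal insertion constant is `≍ M₂/κ²`
(between a third of the truncated second moment and four times the full one), i.e. (A) holds iff
the mean-free-path distribution has a finite `w`-second moment, and then with `C ≍ M₂/κ²`. [folklore] -/
theorem slab_insertion_defect_le {ι : Type*} (S : Finset ι) (w ℓ : ι → ℝ)
    (hw : ∀ m ∈ S, 0 ≤ w m) (hℓ : ∀ m ∈ S, 0 < ℓ m) (hκ : 0 < ∑ m ∈ S, w m * ℓ m)
    (κN : ℝ → ℝ) (hκN : ∀ x, κN x = ∑ m ∈ S, w m * ℓ m * (x / (x + ℓ m)))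
    {x y : ℝ} (hx0 : 0 < x) (hy0 : 0 < y)
    (hx : 2 * (∑ m ∈ S, w m * ℓ m ^ 2) / (∑ m ∈ S, w m * ℓ m) ≤ x)
    (hy : 2 * (∑ m ∈ S, w m * ℓ m ^ 2) / (∑ m ∈ S, w m * ℓ m) ≤ y) :
    x / κN x + y / κN y - (x + y) / κN (x + y)
      ≤ 4 * (∑ m ∈ S, w m * ℓ m ^ 2) / (∑ m ∈ S, w m * ℓ m) ^ 2 := by
  set κ := ∑ m ∈ S, w m * ℓ m with hκdef
  set M₂ := ∑ m ∈ S, w m * ℓ m ^ 2 with hM₂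
  have hM₂0 : 0 ≤ M₂ := Finset.sum_nonneg fun m hm => by
    have := hw m hm; positivity
  -- κ - κ_z ≤ M₂ / z and κ_z ≤ κ
  have hle : ∀ z : ℝ, 0 < z → κN z ≤ κ := by
    intro z hz
    rw [hκN]
    refine Finset.sum_le_sum fun m hm => ?_
    have h1 : z / (z + ℓ m) ≤ 1 := by
      rw [div_le_one (by linarith [hℓ m hm])]; linarith [hℓ m hm]
    have h0 : 0 ≤ w m * ℓ m := mul_nonneg (hw m hm) (hℓ m hm).le
    calc w m * ℓ m * (z / (z + ℓ m)) ≤ w m * ℓ m * 1 := mul_le_mul_of_nonneg_left h1 h0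
      _ = w m * ℓ m := mul_one _
  have hdef : ∀ z : ℝ, 0 < z → κ - κN z ≤ M₂ / z := by
    intro z hz
    have : κ - κN z = ∑ m ∈ S, w m * ℓ m * (ℓ m / (z + ℓ m)) := by
      rw [hκdef, hκN, ← Finset.sum_sub_distrib]
      refine Finset.sum_congr rfl fun m hm => ?_
      have h1 : z + ℓ m ≠ 0 := by linarith [hℓ m hm]
      field_simp
      ring
    rw [this, hM₂, Finset.sum_div]
    refine Finset.sum_le_sum fun m hm => ?_
    have hl := hℓ m hm; have hw' := hw m hm
    have hfrac : ℓ m / (z + ℓ m) ≤ ℓ m / z :=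
      div_le_div_of_nonneg_left hl.le hz (by linarith)
    calc w m * ℓ m * (ℓ m / (z + ℓ m)) ≤ w m * ℓ m * (ℓ m / z) :=
          mul_le_mul_of_nonneg_left hfrac (by positivity)
      _ = w m * ℓ m ^ 2 / z := by ring
  -- for z ≥ 2 M₂/κ: κ_z ≥ κ/2 and z/κ_z - z/κ ≤ 2 M₂/κ²
  have hhalf : ∀ z : ℝ, 0 < z → 2 * M₂ / κ ≤ z → κ / 2 ≤ κN z := by
    intro z hz hzl
    have h1 := hdef z hz
    have h2 : M₂ / z ≤ κ / 2 := by
      rw [div_le_iff₀ hz]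
      rw [div_le_iff₀ hκ] at hzl
      linarith
    linarith
  have hexcess : ∀ z : ℝ, 0 < z → 2 * M₂ / κ ≤ z → z / κN z ≤ z / κ + 2 * M₂ / κ ^ 2 := by
    intro z hz hzl
    have hkz : κ / 2 ≤ κN z := hhalf z hz hzl
    have hkz0 : 0 < κN z := by linarith
    have h1 := hdef z hz
    -- z/κ_z - z/κ = z (κ - κ_z)/(κ κ_z) ≤ z (M₂/z) / (κ · κ/2)
    have h2 : z / κN z - z / κ = z * (κ - κN z) / (κ * κN z) := by
      field_simp
    have h3 : z * (κ - κN z) / (κ * κN z) ≤ z * (M₂ / z) / (κ * (κ / 2)) := by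
      have hnum : z * (κ - κN z) ≤ z * (M₂ / z) := mul_le_mul_of_nonneg_left h1 hz.le
      have hnum0 : 0 ≤ z * (M₂ / z) := by positivity
      calc z * (κ - κN z) / (κ * κN z) ≤ z * (M₂ / z) / (κ * κN z) :=
            div_le_div_of_nonneg_right hnum (by positivity)
        _ ≤ z * (M₂ / z) / (κ * (κ / 2)) :=
            div_le_div_of_nonneg_left hnum0 (by positivity)
              (mul_le_mul_of_nonneg_left hkz hκ.le)
    have h4 : z * (M₂ / z) / (κ * (κ / 2)) = 2 * M₂ / κ ^ 2 := by
      field_simp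
    linarith
  have hxy0 : 0 < x + y := by linarith
  have hxyl : 2 * M₂ / κ ≤ x + y := le_trans hx (by linarith)
  have hk3 : κ / 2 ≤ κN (x + y) := hhalf (x + y) hxy0 hxyl
  have hk30 : 0 < κN (x + y) := by linarith
  have hlast : (x + y) / κ ≤ (x + y) / κN (x + y) :=
    div_le_div_of_nonneg_left hxy0.le hk30 (hle (x + y) hxy0)
  have e1 := hexcess x hx0 hx
  have e2 := hexcess y hy0 hy
  have hsplit : (x + y) / κ = x / κ + y / κ := by ring
  have hfinal : 4 * M₂ / κ ^ 2 = 2 * M₂ / κ ^ 2 + 2 * M₂ / κ ^ 2 := by ring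
  linarith

/-! ## Load-bearing analysis: the shell without dynamics is false -/

/-- **Any proof of (A) must use the dynamics**: the bare shell is false.  Witness
`D_N = (N-1)/(N + √N)` (`R_N = N + N^{1/2}`, positive response), killed by the power-law criterion.
(Same content as the one-shot refuter's evidence `Shell.lean`, re-derived from the power-law criterion.) [folklore] -/
theorem superadditiveResistance_false_without_dynamics :
    ¬ ∀ D : ℕ → ℝ, (∀ N : ℕ, 2 ≤ N → 0 < D N) →
      (∃ C : ℝ, ∀ N M : ℕ, 2 ≤ N → 2 ≤ M →
      ((N : ℝ) - 1) / D N + ((M : ℝ) - 1) / D M - C ≤ ((N : ℝ) + (M : ℝ) - 1) / D (N + M)) := by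
  intro h
  set D : ℕ → ℝ := fun N => ((N : ℝ) - 1) / ((N : ℝ) + (N : ℝ) ^ (1 / 2 : ℝ)) with hD
  have hpos : ∀ N : ℕ, 2 ≤ N → 0 < D N := by
    intro N hN
    have hN1 : (1 : ℝ) < N := by exact_mod_cast hN
    have hNs : (0 : ℝ) ≤ (N : ℝ) ^ (1 / 2 : ℝ) := Real.rpow_nonneg (by linarith) _
    exact div_pos (by linarith) (by linarith)
  refine not_insertionBounded_of_rpow_correction (D := D) 1 0 1 (1 / 2) one_pos (by norm_num)
    (by norm_num) ?_ (h D hpos)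
  intro N hN
  have hN1 : (1 : ℝ) < N := by exact_mod_cast hN
  have hNs : (0 : ℝ) ≤ (N : ℝ) ^ (1 / 2 : ℝ) := Real.rpow_nonneg (by linarith) _
  have hden : (N : ℝ) + (N : ℝ) ^ (1 / 2 : ℝ) ≠ 0 := by linarith
  have hnum : (N : ℝ) - 1 ≠ 0 := by linarith
  rw [hD]
  field_simp
  ring

end Summit.AtomisticToContinuum.FouriersLaw.Theorems.SuperadditiveResistance.Negative

end
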